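import Summits.ResolutionOfSingularities.ResolutionOfSingularities.Theorems.WeightedInvariantELadderOneRung
import Summits.ResolutionOfSingularities.ResolutionOfSingularities.Theorems.WeightedInvariantELadderOneCentreUnconditional
import HarnessLib

/-!
# Rung `e = 1` of the door `HypersurfaceCentreConstruction`, UNCONDITIONALLY:
# `AdmissiblyResolvableDim p 1` in every characteristic

Route `ResolutionOfSingularities/WeightedInvariant`, door crux `HypersurfaceCentreConstruction`
(stmt-ResolutionOfSingularities-19897) — OURS; e-ladder `e = 1` (res-D-pv-025 AS stub-10).  The registered composition
`ELadderOne.admissiblyResolvableDim_one_of_AQS (hAQS₁) (hAQS₂) p` (p520391) took the two Abramovich–Quek–Schober facts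
as hypotheses.  With `ELadderOne.exists_isAdmissibleCentre` (file `…ELadderOneCentreUnconditional`: `hAQS₁` =
`AQSHeightTwo.AbramovichQuekSchober2025_heightTwoCentre_holds` of the (o25) team, `hAQS₂` discharged at `k(ℤʲ)` by
`AQSBaseChange.separableBaseChange_of_essFiniteType`) the same strong induction on `Stage.mu` gives:

* `e1_assembly_unconditional` — every stage satisfying `Inv′` has a resolvable hypersurface pair;
* **`admissiblyResolvableDim_one (p : ℕ) : AdmissiblyResolvableDim p 1`** — rung `e = 1` of the door, with NO
  hypothesis; `nonempty_choiceDim_one : Nonempty (HypersurfaceCentreChoiceDim p 1)`.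

WHAT THE KERNEL SAYS (honest framing): every hypersurface pair over a perfect field `k` of characteristic `p` whose
hypersurface is an integral CURVE in a smooth separated quasi-compact ambient admits an admissible resolution sequence
in OUR sense (`AdmissiblyResolvableDim`, weighted centres / cobordant blow-ups à la Abramovich–Quek–Schober–Włodarczyk).
This is a theorem about OUR typed objects; it is NOT a statement of H. Hironaka's manuscript and makes no claim about it.
AI-written, weaker than expert review.  [cite: AbramovichQuekSchober2025, Thm 1.1, Thm 1.3; Wlodarczyk2022]
-/

noncomputable section

set_option linter.dupNamespace false -- mandated namespace of this single-conjunct summit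

open CategoryTheory AlgebraicGeometry TopologicalSpace IsLocalRing
open Literature.AlgebraicGeometry.Resolution
open Summit.ResolutionOfSingularities.ResolutionOfSingularities.Theorems

namespace Summit.ResolutionOfSingularities.ResolutionOfSingularities.Theorems.ELadderOne

variable {k : Type} [Field k]

/-- **The kernel glue of rung `e = 1`, unconditionally** (skeleton v3.6 `e1_assembly` text with the centre of
`exists_isAdmissibleCentre`): strong induction on `Stage.mu` along the cobordant tower. [folklore] -/
theorem e1_assembly_unconditional {p : ℕ} [CharP k p] [PerfectField k]
    (S : Stage k) (hInv : S.Inv') : S.toPair.Resolvable := by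
  suffices h : ∀ (m : ℕ∞) (S : Stage k), S.Inv' → S.mu = m → S.toPair.Resolvable from
    h _ S hInv rfl
  intro m
  induction m using WellFoundedLT.induction with
  | ind m ih =>
  intro S hInv hm
  by_cases hreg : Scheme.IsRegular S.X
  · -- resolved: no step
    exact HypersurfacePair.resolvable_of_isRegular _ ((isRegular_iff_isRegular_image S.i).mp hreg)
  · -- one admissible step, then the induction hypothesis at the successor stage
    obtain ⟨R, hadm, hsupp, hdrop⟩ := exists_isAdmissibleCentre S hInv hreg
    have hc : R.IsRegularWeightedCentre := hadm.1
    haveI : IsLocallyNoetherian S.Y := LocallyOfFiniteType.isLocallyNoetherian S.f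
    have hY : Scheme.IsRegular S.Y := Scheme.IsRegular.of_smooth S.f (Scheme.isRegular_Spec (.of k))
    -- the generic point of `X` is off the centre (support = singular image; the function field is regular)
    have hξ : S.i (genericPoint S.X) ∉ R.support := by
      rw [hsupp]
      rintro ⟨x', hx', hnreg⟩
      obtain ⟨x₀, rfl⟩ := S.i.toImage.surjective x'
      rw [toImage_apply_eq_iff] at hx'
      obtain rfl : x₀ = genericPoint S.X := S.i.isClosedEmbedding.injective hx'
      exact hnreg ((isRegularLocalRing_stalk_image_iff S.i (genericPoint S.X)).mpr
        (inferInstanceAs (IsRegularLocalRing S.X.functionField)))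
    -- the Rees filtration of the centre and the successor ambient
    let R' : ReesFiltration S.Y :=
      { ideal := R.piece
        ideal_zero := R.piece_zero
        antitone := antitone_piece hc
        mul_le := R.piece_mul_le }
    obtain ⟨hsm', hsep', hqc'⟩ :=
      WeightedThesis.GlobalCobordantPlus.smooth_πPlus_comp_of_isRegularWeightedCentre S.f R hc R' rfl
    haveI := hsm'; haveI := hsep'; haveI := hqc'
    obtain ⟨hint', hker⟩ :=
      DatumToEmbedded.StrictTransform.isIntegral_strictTransformPlus_of_not_mem_support S.i R hc R' rfl hξ
    haveI := hint'
    set I' := R'.strictTransformPlus S.i.ker with hI'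
    have hI'lp : IsLocallyPrincipal I' :=
      WeightedThesis.HypersurfacePreserved.isLocallyPrincipal_strictTransformPlus hY R hc R' rfl S.i.ker
        S.isLocallyPrincipal
    let i' := I'.subschemeι
    have hlp' : IsLocallyPrincipal i'.ker := by
      rw [Scheme.IdealSheafData.ker_subschemeι]; exact hI'lp
    let σX : I'.subscheme ⟶ S.X := IsClosedImmersion.lift S.i (i' ≫ R'.πPlus) hker
    have hσX : σX ≫ S.i = i' ≫ R'.πPlus := IsClosedImmersion.lift_fac _ _ _
    -- (hom) of the admissible centre on the charts of the presentation, then the tree's quotient step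
    have hH := hadm.2.2
    have hhom : ∀ (a : S.atlas.ι) (n : ℕ), @Ideal.IsHomogeneous (Fin S.j → ℤ)
        (AddSubgroup Γ(S.Y, S.atlas.W a)) Γ(S.Y, S.atlas.W a) _ _ _ (S.atlas.piece a) _ _
        (S.atlas.gradedRing a) ((R.piece n).ideal (S.atlas.W a)) := fun a n =>
      @hH S.j (S.atlas.W a) (S.atlas.piece a) (S.atlas.gradedRing a) (S.atlas.appLE_mem a)
        (S.atlas.isHomogeneous_ker a) n
    obtain ⟨K, hK, hstep⟩ := DatumToEmbedded.quotientStep_of_isRegularWeightedCentre S.f S.i S.q S.g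
      S.hq S.atlas R hc hξ hhom R' rfl σX hσX
    obtain ⟨V', ρ, hρ⟩ := exists_isBlowup S.V K
    haveI : IsLocallyNoetherian S.V := LocallyOfFiniteType.isLocallyNoetherian S.g
    haveI : IsProper ρ := hρ.isProper
    haveI : IsIntegral V' := hρ.isIntegral hK
    obtain ⟨q', hq', ⟨𝒜'⟩⟩ := hstep V' ρ hρ
    have hq'' : q' ≫ ρ ≫ S.g = i' ≫ R'.πPlus ≫ S.f := by
      rw [← Category.assoc, hq', Category.assoc, S.hq, ← Category.assoc, hσX, Category.assoc]
    -- the successor stage: invariant and measure drop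
    let S' : Stage k :=
      { Y := R'.plus, f := R'.πPlus ≫ S.f, X := (R'.strictTransformPlus S.i.ker).subscheme,
        i := (R'.strictTransformPlus S.i.ker).subschemeι, isLocallyPrincipal := hlp',
        V := V', q := q', g := ρ ≫ S.g, hq := hq'', j := S.j + 1, atlas := 𝒜' }
    obtain ⟨hInv', hlt⟩ : S'.Inv' ∧ S'.mu < S.mu :=
      stub_e1_inv_succ S hInv hreg R hadm hsupp R' rfl (hdrop R' rfl) hlp' V' ρ q' hq'' 𝒜'
    -- the induction hypothesis resolves the successor
    obtain ⟨n, hn⟩ := ih _ (hm ▸ hlt) S' hInv' rfl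
    -- one more step for `S`
    refine ⟨n + 1, R, hadm, R', rfl, hsm', hsep', hqc', hI'lp, hint', ?_⟩
    have e : (@HypersurfacePair.mk k _ R'.plus (R'.πPlus ≫ S.f) hsm' hsep' hqc' I' hI'lp hint') =
        S'.toPair := by
      simp only [S', Stage.toPair, HypersurfacePair.ofKer]
      congr 1
      exact (Scheme.IdealSheafData.ker_subschemeι I').symm
    rw [← e] at hn
    exact hn


/-! ## The rung, with no hypothesis -/

/-- **RUNG `e = 1` OF THE DOOR, UNCONDITIONALLY: `AdmissiblyResolvableDim p 1`** — admissible resolvability from start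
dimension `1` in every characteristic `p`. [cite: AbramovichQuekSchober2025, Thm 1.1, Thm 1.3] -/
theorem admissiblyResolvableDim_one (p : ℕ) : AdmissiblyResolvableDim p 1 := by
  intro k _ _ _ P hdim _
  obtain ⟨S, hInv, _, hSP⟩ := stub_e1_base' P hdim
  rw [← hSP]
  exact e1_assembly_unconditional (p := p) S hInv

/-- … hence choice-rung 1, unconditionally. [folklore] -/
theorem nonempty_choiceDim_one (p : ℕ) : Nonempty (HypersurfaceCentreChoiceDim p 1) :=
  nonempty_choiceDim_of_admissiblyResolvableDim (admissiblyResolvableDim_one p)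

end Summit.ResolutionOfSingularities.ResolutionOfSingularities.Theorems.ELadderOne

end
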